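import Summits.ValiantsHypothesis.ValiantsHypothesis.Theorems.LacunarySymmetroidMatrixDescartesDoorA26ClosureChamberBridge
import Summits.ValiantsHypothesis.ValiantsHypothesis.Theorems.LacunarySymmetroidMatrixDescartesCensusChamber300
import Summits.ValiantsHypothesis.ValiantsHypothesis.Theorems.LacunarySymmetroidMatrixDescartesCensusChamber301
import Summits.ValiantsHypothesis.ValiantsHypothesis.Theorems.LacunarySymmetroidMatrixDescartesCensusChamber142
import Summits.ValiantsHypothesis.ValiantsHypothesis.Theorems.LacunarySymmetroidMatrixDescartesCensusChamber148
import Summits.ValiantsHypothesis.ValiantsHypothesis.Theorems.LacunarySymmetroidMatrixDescartesCensusChamber119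
import Summits.ValiantsHypothesis.ValiantsHypothesis.Theorems.LacunarySymmetroidMatrixDescartesCensusChamber123
import Summits.ValiantsHypothesis.ValiantsHypothesis.Theorems.LacunarySymmetroidMatrixDescartesCensusChamber859
import Summits.ValiantsHypothesis.ValiantsHypothesis.Theorems.LacunarySymmetroidMatrixDescartesCensusChamber951
import Summits.ValiantsHypothesis.ValiantsHypothesis.Theorems.LacunarySymmetroidMatrixDescartesCensusChamber354
import Summits.ValiantsHypothesis.ValiantsHypothesis.Theorems.LacunarySymmetroidMatrixDescartesCensusChamber430
import Summits.ValiantsHypothesis.ValiantsHypothesis.Theorems.LacunarySymmetroidMatrixDescartesCensusChamber351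
import Summits.ValiantsHypothesis.ValiantsHypothesis.Theorems.LacunarySymmetroidMatrixDescartesCensusChamber427

/-!
# `DoorA26` / `TripleStratum26` — SIX VALUE-GENERIC TRIPLE-STRATUM COMPONENTS CLOSED BY CENSUS CHAMBER ROWS (no analysis)

HONEST FRAMING.  Object-search cell `pub-symmetroid`, door-A target `DoorA26 := PosRootLawAt 2 6 19`
(stmt-ValiantsHypothesis-19979; OPEN, typed, never asserted).  Seat val-sym-door-p2 g16.  Helper toward the hypothesis
`TripleStratum26` of `Cruxes/DoorA26/Lines/wall_bubbling_ConfluentDoor.lean` (rev 13): «a value-generic point of the sorted simplex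
with a TRIPLE coincidence is not in `closure TwentyLocus`».

A value-generic triple point `δ₀` of composition `(1,1,3,1)` (`δ₀ 2 = δ₀ 3 = δ₀ 4`, the other letters and all class pair sums
distinct) or `(1,3,1,1)` (`δ₀ 1 = δ₀ 2 = δ₀ 3`) lies in one of 10 COMPONENTS = the 10 orders of the ten class pair sums (the
`(2,4)` chambers of the four class values); an integer support inheriting the strict pair-sum inequalities of `δ₀` lies, once
sorted, in one of exactly TWO `(2,6)` chambers (the split `2d₃ ≶ d₂ + d₄`, resp. `2d₂ ≶ d₁ + d₃`; equality is a collided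
support, free by Descartes).  For SIX components both chambers carry a KERNEL ROW of the census (`doorA26_on_chamber<n>`,
engines / door seats 2026-08-27…29): `(1,1,3,1)` at the reduced orders of `(0,3,5,9)` [chambers 300, 301], `(0,4,6,9)`
[142, 148], `(0,4,7,9)` [119, 123]; `(1,3,1,1)` at `(0,2,5,9)` [859, 951], `(0,3,5,9)` [354, 430], `(0,4,6,9)` [351, 427]
(located enumeration `exp/strata.py` of this seat over theory g6's table of the 2 608 chambers: 63 value-generic triple
components in all, 6 fully certified today).  By the census → closure bridge (`not_mem_closure_bubblingTwentyLocus_of_sortedRows`,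
`…DoorA26ClosureChamberBridge`) these six components are outside `closure Bubbling.TwentyLocus` — the conclusion of
`TripleStratum26` there, single- AND multi-cluster, with no asymptotic analysis.

Each theorem: hypotheses = `δ₀ ∈ Bubbling.SortedSimplex`, the two coincidences, and the chain of the nine strict inequalities
between consecutive class pair sums (representative letters); conclusion `δ₀ ∉ closure Bubbling.TwentyLocus`.
The other 57 components (in particular ALL components with the triple at the bottom or at the top, which abut the hard
chambers 1 / 954 / 1706 / 1709 and their mirrors) are NOT covered.  Nothing here bears on `DoorA26` as a whole, on
`MatrixDescartes` (stmt-ValiantsHypothesis-18050) or on `VP ≠ VNP`; `TripleStratum26`, (W), (M), (R) OPEN.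
`--supports stmt-ValiantsHypothesis-19979 --as helper`.

[folklore] Bookkeeping over kernel rows already in the tree; no citation exists or is needed.
-/

-- `Summit.ValiantsHypothesis.ValiantsHypothesis.…` repeats a component by the D-0017 layout
-- (single-conjunct summit), which the `dupNamespace` linter flags; the name is mandated.
set_option linter.dupNamespace false

namespace Summit.ValiantsHypothesis.ValiantsHypothesis.Theorems.LacunarySymmetroidMatrixDescartes.Census.RealExp

open Summit.ValiantsHypothesis.ValiantsHypothesis.Theorems.LacunarySymmetroidMatrixDescartes.WallBubbling

/-- Pair sums increasing along an explicit order of the 21 pairs: a chain of 20 consecutive inequalities suffices. [folklore] -/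
theorem strictMono_pairSum_of_isChain (d : Fin 6 → ℕ) (σ : Fin 21 → Fin 6 × Fin 6)
    (h : List.IsChain (· < ·) (List.ofFn ((fun p : Fin 6 × Fin 6 => d p.1 + d p.2) ∘ σ))) :
    StrictMono ((fun p : Fin 6 × Fin 6 => d p.1 + d p.2) ∘ σ) :=
  List.sortedLT_ofFn_iff.mp (List.sortedLT_iff_isChain.mpr h)


/-- **Component `(1, 1, 3, 1)` at the reduced order of `(0, 3, 5, 9)` is outside `closure TwentyLocus`** (refining chambers 300, 301, both kernel rows). [this work] -/
theorem tripleStratum_oneOneThreeOne_0359 (δ₀ : Fin 6 → ℝ) (hΔ : δ₀ ∈ Bubbling.SortedSimplex)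
    (ht₁ : δ₀ 2 = δ₀ 3) (ht₂ : δ₀ 3 = δ₀ 4)
    (hR : δ₀ 0 + δ₀ 0 < δ₀ 0 + δ₀ 1 ∧
      δ₀ 0 + δ₀ 1 < δ₀ 0 + δ₀ 2 ∧
      δ₀ 0 + δ₀ 2 < δ₀ 1 + δ₀ 1 ∧
      δ₀ 1 + δ₀ 1 < δ₀ 1 + δ₀ 2 ∧
      δ₀ 1 + δ₀ 2 < δ₀ 0 + δ₀ 5 ∧
      δ₀ 0 + δ₀ 5 < δ₀ 2 + δ₀ 2 ∧
      δ₀ 2 + δ₀ 2 < δ₀ 1 + δ₀ 5 ∧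
      δ₀ 1 + δ₀ 5 < δ₀ 2 + δ₀ 5 ∧
      δ₀ 2 + δ₀ 5 < δ₀ 5 + δ₀ 5) :
    δ₀ ∉ closure Bubbling.TwentyLocus := by
  obtain ⟨c1, c2, c3, c4, c5, c6, c7, c8, c9⟩ := hR
  refine not_mem_closure_bubblingTwentyLocus_of_sortedRows δ₀ hΔ.1 fun d hd hinh => ?_
  have l₁ : d 2 < d 3 := hd (by decide)
  have l₂ : d 3 < d 4 := hd (by decide)
  have i0 : d 0 + d 0 < d 0 + d 1 :=
    hinh (0, 0) (0, 1) (by decide) (by decide)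
      (show δ₀ 0 + δ₀ 0 < δ₀ 0 + δ₀ 1 by linarith)
  have i1 : d 0 + d 1 < d 0 + d 2 :=
    hinh (0, 1) (0, 2) (by decide) (by decide)
      (show δ₀ 0 + δ₀ 1 < δ₀ 0 + δ₀ 2 by linarith)
  have i2 : d 0 + d 4 < d 1 + d 1 :=
    hinh (0, 4) (1, 1) (by decide) (by decide)
      (show δ₀ 0 + δ₀ 4 < δ₀ 1 + δ₀ 1 by linarith)
  have i3 : d 1 + d 1 < d 1 + d 2 :=
    hinh (1, 1) (1, 2) (by decide) (by decide)
      (show δ₀ 1 + δ₀ 1 < δ₀ 1 + δ₀ 2 by linarith)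
  have i4 : d 1 + d 4 < d 0 + d 5 :=
    hinh (1, 4) (0, 5) (by decide) (by decide)
      (show δ₀ 1 + δ₀ 4 < δ₀ 0 + δ₀ 5 by linarith)
  have i5 : d 0 + d 5 < d 2 + d 2 :=
    hinh (0, 5) (2, 2) (by decide) (by decide)
      (show δ₀ 0 + δ₀ 5 < δ₀ 2 + δ₀ 2 by linarith)
  have i6 : d 4 + d 4 < d 1 + d 5 :=
    hinh (4, 4) (1, 5) (by decide) (by decide)
      (show δ₀ 4 + δ₀ 4 < δ₀ 1 + δ₀ 5 by linarith)
  have i7 : d 1 + d 5 < d 2 + d 5 :=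
    hinh (1, 5) (2, 5) (by decide) (by decide)
      (show δ₀ 1 + δ₀ 5 < δ₀ 2 + δ₀ 5 by linarith)
  have i8 : d 4 + d 5 < d 5 + d 5 :=
    hinh (4, 5) (5, 5) (by decide) (by decide)
      (show δ₀ 4 + δ₀ 5 < δ₀ 5 + δ₀ 5 by linarith)
  rcases lt_trichotomy (d 3 + d 3) (d 2 + d 4) with hlt | heq | hgt
  · refine doorA26_on_chamber301 d (strictMono_pairSum_of_isChain d _ ?_)
    simp only [List.ofFn_succ, List.ofFn_zero, Function.comp_apply, Matrix.cons_val_succ, Matrix.cons_val_zero, List.isChain_cons_cons, List.isChain_singleton, and_true, Fin.isValue]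
    omega
  · exact posRootLawOn_of_pairSum_collision d (3, 3) (2, 4) (by decide) (by decide)
      (by decide) heq
  · refine doorA26_on_chamber300 d (strictMono_pairSum_of_isChain d _ ?_)
    simp only [List.ofFn_succ, List.ofFn_zero, Function.comp_apply, Matrix.cons_val_succ, Matrix.cons_val_zero, List.isChain_cons_cons, List.isChain_singleton, and_true, Fin.isValue]
    omega

/-- **Component `(1, 1, 3, 1)` at the reduced order of `(0, 4, 6, 9)` is outside `closure TwentyLocus`** (refining chambers 142, 148, both kernel rows). [this work] -/
theorem tripleStratum_oneOneThreeOne_0469 (δ₀ : Fin 6 → ℝ) (hΔ : δ₀ ∈ Bubbling.SortedSimplex)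
    (ht₁ : δ₀ 2 = δ₀ 3) (ht₂ : δ₀ 3 = δ₀ 4)
    (hR : δ₀ 0 + δ₀ 0 < δ₀ 0 + δ₀ 1 ∧
      δ₀ 0 + δ₀ 1 < δ₀ 0 + δ₀ 2 ∧
      δ₀ 0 + δ₀ 2 < δ₀ 1 + δ₀ 1 ∧
      δ₀ 1 + δ₀ 1 < δ₀ 0 + δ₀ 5 ∧
      δ₀ 0 + δ₀ 5 < δ₀ 1 + δ₀ 2 ∧
      δ₀ 1 + δ₀ 2 < δ₀ 2 + δ₀ 2 ∧
      δ₀ 2 + δ₀ 2 < δ₀ 1 + δ₀ 5 ∧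
      δ₀ 1 + δ₀ 5 < δ₀ 2 + δ₀ 5 ∧
      δ₀ 2 + δ₀ 5 < δ₀ 5 + δ₀ 5) :
    δ₀ ∉ closure Bubbling.TwentyLocus := by
  obtain ⟨c1, c2, c3, c4, c5, c6, c7, c8, c9⟩ := hR
  refine not_mem_closure_bubblingTwentyLocus_of_sortedRows δ₀ hΔ.1 fun d hd hinh => ?_
  have l₁ : d 2 < d 3 := hd (by decide)
  have l₂ : d 3 < d 4 := hd (by decide)
  have i0 : d 0 + d 0 < d 0 + d 1 :=
    hinh (0, 0) (0, 1) (by decide) (by decide)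
      (show δ₀ 0 + δ₀ 0 < δ₀ 0 + δ₀ 1 by linarith)
  have i1 : d 0 + d 1 < d 0 + d 2 :=
    hinh (0, 1) (0, 2) (by decide) (by decide)
      (show δ₀ 0 + δ₀ 1 < δ₀ 0 + δ₀ 2 by linarith)
  have i2 : d 0 + d 4 < d 1 + d 1 :=
    hinh (0, 4) (1, 1) (by decide) (by decide)
      (show δ₀ 0 + δ₀ 4 < δ₀ 1 + δ₀ 1 by linarith)
  have i3 : d 1 + d 1 < d 0 + d 5 :=
    hinh (1, 1) (0, 5) (by decide) (by decide)
      (show δ₀ 1 + δ₀ 1 < δ₀ 0 + δ₀ 5 by linarith)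
  have i4 : d 0 + d 5 < d 1 + d 2 :=
    hinh (0, 5) (1, 2) (by decide) (by decide)
      (show δ₀ 0 + δ₀ 5 < δ₀ 1 + δ₀ 2 by linarith)
  have i5 : d 1 + d 4 < d 2 + d 2 :=
    hinh (1, 4) (2, 2) (by decide) (by decide)
      (show δ₀ 1 + δ₀ 4 < δ₀ 2 + δ₀ 2 by linarith)
  have i6 : d 4 + d 4 < d 1 + d 5 :=
    hinh (4, 4) (1, 5) (by decide) (by decide)
      (show δ₀ 4 + δ₀ 4 < δ₀ 1 + δ₀ 5 by linarith)
  have i7 : d 1 + d 5 < d 2 + d 5 :=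
    hinh (1, 5) (2, 5) (by decide) (by decide)
      (show δ₀ 1 + δ₀ 5 < δ₀ 2 + δ₀ 5 by linarith)
  have i8 : d 4 + d 5 < d 5 + d 5 :=
    hinh (4, 5) (5, 5) (by decide) (by decide)
      (show δ₀ 4 + δ₀ 5 < δ₀ 5 + δ₀ 5 by linarith)
  rcases lt_trichotomy (d 3 + d 3) (d 2 + d 4) with hlt | heq | hgt
  · refine doorA26_on_chamber148 d (strictMono_pairSum_of_isChain d _ ?_)
    simp only [List.ofFn_succ, List.ofFn_zero, Function.comp_apply, Matrix.cons_val_succ, Matrix.cons_val_zero, List.isChain_cons_cons, List.isChain_singleton, and_true, Fin.isValue]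
    omega
  · exact posRootLawOn_of_pairSum_collision d (3, 3) (2, 4) (by decide) (by decide)
      (by decide) heq
  · refine doorA26_on_chamber142 d (strictMono_pairSum_of_isChain d _ ?_)
    simp only [List.ofFn_succ, List.ofFn_zero, Function.comp_apply, Matrix.cons_val_succ, Matrix.cons_val_zero, List.isChain_cons_cons, List.isChain_singleton, and_true, Fin.isValue]
    omega

/-- **Component `(1, 1, 3, 1)` at the reduced order of `(0, 4, 7, 9)` is outside `closure TwentyLocus`** (refining chambers 119, 123, both kernel rows). [this work] -/
theorem tripleStratum_oneOneThreeOne_0479 (δ₀ : Fin 6 → ℝ) (hΔ : δ₀ ∈ Bubbling.SortedSimplex)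
    (ht₁ : δ₀ 2 = δ₀ 3) (ht₂ : δ₀ 3 = δ₀ 4)
    (hR : δ₀ 0 + δ₀ 0 < δ₀ 0 + δ₀ 1 ∧
      δ₀ 0 + δ₀ 1 < δ₀ 0 + δ₀ 2 ∧
      δ₀ 0 + δ₀ 2 < δ₀ 1 + δ₀ 1 ∧
      δ₀ 1 + δ₀ 1 < δ₀ 0 + δ₀ 5 ∧
      δ₀ 0 + δ₀ 5 < δ₀ 1 + δ₀ 2 ∧
      δ₀ 1 + δ₀ 2 < δ₀ 1 + δ₀ 5 ∧
      δ₀ 1 + δ₀ 5 < δ₀ 2 + δ₀ 2 ∧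
      δ₀ 2 + δ₀ 2 < δ₀ 2 + δ₀ 5 ∧
      δ₀ 2 + δ₀ 5 < δ₀ 5 + δ₀ 5) :
    δ₀ ∉ closure Bubbling.TwentyLocus := by
  obtain ⟨c1, c2, c3, c4, c5, c6, c7, c8, c9⟩ := hR
  refine not_mem_closure_bubblingTwentyLocus_of_sortedRows δ₀ hΔ.1 fun d hd hinh => ?_
  have l₁ : d 2 < d 3 := hd (by decide)
  have l₂ : d 3 < d 4 := hd (by decide)
  have i0 : d 0 + d 0 < d 0 + d 1 :=
    hinh (0, 0) (0, 1) (by decide) (by decide)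
      (show δ₀ 0 + δ₀ 0 < δ₀ 0 + δ₀ 1 by linarith)
  have i1 : d 0 + d 1 < d 0 + d 2 :=
    hinh (0, 1) (0, 2) (by decide) (by decide)
      (show δ₀ 0 + δ₀ 1 < δ₀ 0 + δ₀ 2 by linarith)
  have i2 : d 0 + d 4 < d 1 + d 1 :=
    hinh (0, 4) (1, 1) (by decide) (by decide)
      (show δ₀ 0 + δ₀ 4 < δ₀ 1 + δ₀ 1 by linarith)
  have i3 : d 1 + d 1 < d 0 + d 5 :=
    hinh (1, 1) (0, 5) (by decide) (by decide)
      (show δ₀ 1 + δ₀ 1 < δ₀ 0 + δ₀ 5 by linarith)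
  have i4 : d 0 + d 5 < d 1 + d 2 :=
    hinh (0, 5) (1, 2) (by decide) (by decide)
      (show δ₀ 0 + δ₀ 5 < δ₀ 1 + δ₀ 2 by linarith)
  have i5 : d 1 + d 4 < d 1 + d 5 :=
    hinh (1, 4) (1, 5) (by decide) (by decide)
      (show δ₀ 1 + δ₀ 4 < δ₀ 1 + δ₀ 5 by linarith)
  have i6 : d 1 + d 5 < d 2 + d 2 :=
    hinh (1, 5) (2, 2) (by decide) (by decide)
      (show δ₀ 1 + δ₀ 5 < δ₀ 2 + δ₀ 2 by linarith)
  have i7 : d 4 + d 4 < d 2 + d 5 :=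
    hinh (4, 4) (2, 5) (by decide) (by decide)
      (show δ₀ 4 + δ₀ 4 < δ₀ 2 + δ₀ 5 by linarith)
  have i8 : d 4 + d 5 < d 5 + d 5 :=
    hinh (4, 5) (5, 5) (by decide) (by decide)
      (show δ₀ 4 + δ₀ 5 < δ₀ 5 + δ₀ 5 by linarith)
  rcases lt_trichotomy (d 3 + d 3) (d 2 + d 4) with hlt | heq | hgt
  · refine doorA26_on_chamber123 d (strictMono_pairSum_of_isChain d _ ?_)
    simp only [List.ofFn_succ, List.ofFn_zero, Function.comp_apply, Matrix.cons_val_succ, Matrix.cons_val_zero, List.isChain_cons_cons, List.isChain_singleton, and_true, Fin.isValue]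
    omega
  · exact posRootLawOn_of_pairSum_collision d (3, 3) (2, 4) (by decide) (by decide)
      (by decide) heq
  · refine doorA26_on_chamber119 d (strictMono_pairSum_of_isChain d _ ?_)
    simp only [List.ofFn_succ, List.ofFn_zero, Function.comp_apply, Matrix.cons_val_succ, Matrix.cons_val_zero, List.isChain_cons_cons, List.isChain_singleton, and_true, Fin.isValue]
    omega

/-- **Component `(1, 3, 1, 1)` at the reduced order of `(0, 2, 5, 9)` is outside `closure TwentyLocus`** (refining chambers 859, 951, both kernel rows). [this work] -/
theorem tripleStratum_oneThreeOneOne_0259 (δ₀ : Fin 6 → ℝ) (hΔ : δ₀ ∈ Bubbling.SortedSimplex)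
    (ht₁ : δ₀ 1 = δ₀ 2) (ht₂ : δ₀ 2 = δ₀ 3)
    (hR : δ₀ 0 + δ₀ 0 < δ₀ 0 + δ₀ 1 ∧
      δ₀ 0 + δ₀ 1 < δ₀ 1 + δ₀ 1 ∧
      δ₀ 1 + δ₀ 1 < δ₀ 0 + δ₀ 4 ∧
      δ₀ 0 + δ₀ 4 < δ₀ 1 + δ₀ 4 ∧
      δ₀ 1 + δ₀ 4 < δ₀ 0 + δ₀ 5 ∧
      δ₀ 0 + δ₀ 5 < δ₀ 4 + δ₀ 4 ∧
      δ₀ 4 + δ₀ 4 < δ₀ 1 + δ₀ 5 ∧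
      δ₀ 1 + δ₀ 5 < δ₀ 4 + δ₀ 5 ∧
      δ₀ 4 + δ₀ 5 < δ₀ 5 + δ₀ 5) :
    δ₀ ∉ closure Bubbling.TwentyLocus := by
  obtain ⟨c1, c2, c3, c4, c5, c6, c7, c8, c9⟩ := hR
  refine not_mem_closure_bubblingTwentyLocus_of_sortedRows δ₀ hΔ.1 fun d hd hinh => ?_
  have l₁ : d 1 < d 2 := hd (by decide)
  have l₂ : d 2 < d 3 := hd (by decide)
  have i0 : d 0 + d 0 < d 0 + d 1 :=
    hinh (0, 0) (0, 1) (by decide) (by decide)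
      (show δ₀ 0 + δ₀ 0 < δ₀ 0 + δ₀ 1 by linarith)
  have i1 : d 0 + d 3 < d 1 + d 1 :=
    hinh (0, 3) (1, 1) (by decide) (by decide)
      (show δ₀ 0 + δ₀ 3 < δ₀ 1 + δ₀ 1 by linarith)
  have i2 : d 3 + d 3 < d 0 + d 4 :=
    hinh (3, 3) (0, 4) (by decide) (by decide)
      (show δ₀ 3 + δ₀ 3 < δ₀ 0 + δ₀ 4 by linarith)
  have i3 : d 0 + d 4 < d 1 + d 4 :=
    hinh (0, 4) (1, 4) (by decide) (by decide)
      (show δ₀ 0 + δ₀ 4 < δ₀ 1 + δ₀ 4 by linarith)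
  have i4 : d 3 + d 4 < d 0 + d 5 :=
    hinh (3, 4) (0, 5) (by decide) (by decide)
      (show δ₀ 3 + δ₀ 4 < δ₀ 0 + δ₀ 5 by linarith)
  have i5 : d 0 + d 5 < d 4 + d 4 :=
    hinh (0, 5) (4, 4) (by decide) (by decide)
      (show δ₀ 0 + δ₀ 5 < δ₀ 4 + δ₀ 4 by linarith)
  have i6 : d 4 + d 4 < d 1 + d 5 :=
    hinh (4, 4) (1, 5) (by decide) (by decide)
      (show δ₀ 4 + δ₀ 4 < δ₀ 1 + δ₀ 5 by linarith)
  have i7 : d 3 + d 5 < d 4 + d 5 :=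
    hinh (3, 5) (4, 5) (by decide) (by decide)
      (show δ₀ 3 + δ₀ 5 < δ₀ 4 + δ₀ 5 by linarith)
  have i8 : d 4 + d 5 < d 5 + d 5 :=
    hinh (4, 5) (5, 5) (by decide) (by decide)
      (show δ₀ 4 + δ₀ 5 < δ₀ 5 + δ₀ 5 by linarith)
  rcases lt_trichotomy (d 2 + d 2) (d 1 + d 3) with hlt | heq | hgt
  · refine doorA26_on_chamber951 d (strictMono_pairSum_of_isChain d _ ?_)
    simp only [List.ofFn_succ, List.ofFn_zero, Function.comp_apply, Matrix.cons_val_succ, Matrix.cons_val_zero, List.isChain_cons_cons, List.isChain_singleton, and_true, Fin.isValue]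
    omega
  · exact posRootLawOn_of_pairSum_collision d (2, 2) (1, 3) (by decide) (by decide)
      (by decide) heq
  · refine doorA26_on_chamber859 d (strictMono_pairSum_of_isChain d _ ?_)
    simp only [List.ofFn_succ, List.ofFn_zero, Function.comp_apply, Matrix.cons_val_succ, Matrix.cons_val_zero, List.isChain_cons_cons, List.isChain_singleton, and_true, Fin.isValue]
    omega

/-- **Component `(1, 3, 1, 1)` at the reduced order of `(0, 3, 5, 9)` is outside `closure TwentyLocus`** (refining chambers 354, 430, both kernel rows). [this work] -/
theorem tripleStratum_oneThreeOneOne_0359 (δ₀ : Fin 6 → ℝ) (hΔ : δ₀ ∈ Bubbling.SortedSimplex)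
    (ht₁ : δ₀ 1 = δ₀ 2) (ht₂ : δ₀ 2 = δ₀ 3)
    (hR : δ₀ 0 + δ₀ 0 < δ₀ 0 + δ₀ 1 ∧
      δ₀ 0 + δ₀ 1 < δ₀ 0 + δ₀ 4 ∧
      δ₀ 0 + δ₀ 4 < δ₀ 1 + δ₀ 1 ∧
      δ₀ 1 + δ₀ 1 < δ₀ 1 + δ₀ 4 ∧
      δ₀ 1 + δ₀ 4 < δ₀ 0 + δ₀ 5 ∧
      δ₀ 0 + δ₀ 5 < δ₀ 4 + δ₀ 4 ∧
      δ₀ 4 + δ₀ 4 < δ₀ 1 + δ₀ 5 ∧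
      δ₀ 1 + δ₀ 5 < δ₀ 4 + δ₀ 5 ∧
      δ₀ 4 + δ₀ 5 < δ₀ 5 + δ₀ 5) :
    δ₀ ∉ closure Bubbling.TwentyLocus := by
  obtain ⟨c1, c2, c3, c4, c5, c6, c7, c8, c9⟩ := hR
  refine not_mem_closure_bubblingTwentyLocus_of_sortedRows δ₀ hΔ.1 fun d hd hinh => ?_
  have l₁ : d 1 < d 2 := hd (by decide)
  have l₂ : d 2 < d 3 := hd (by decide)
  have i0 : d 0 + d 0 < d 0 + d 1 :=
    hinh (0, 0) (0, 1) (by decide) (by decide)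
      (show δ₀ 0 + δ₀ 0 < δ₀ 0 + δ₀ 1 by linarith)
  have i1 : d 0 + d 3 < d 0 + d 4 :=
    hinh (0, 3) (0, 4) (by decide) (by decide)
      (show δ₀ 0 + δ₀ 3 < δ₀ 0 + δ₀ 4 by linarith)
  have i2 : d 0 + d 4 < d 1 + d 1 :=
    hinh (0, 4) (1, 1) (by decide) (by decide)
      (show δ₀ 0 + δ₀ 4 < δ₀ 1 + δ₀ 1 by linarith)
  have i3 : d 3 + d 3 < d 1 + d 4 :=
    hinh (3, 3) (1, 4) (by decide) (by decide)
      (show δ₀ 3 + δ₀ 3 < δ₀ 1 + δ₀ 4 by linarith)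
  have i4 : d 3 + d 4 < d 0 + d 5 :=
    hinh (3, 4) (0, 5) (by decide) (by decide)
      (show δ₀ 3 + δ₀ 4 < δ₀ 0 + δ₀ 5 by linarith)
  have i5 : d 0 + d 5 < d 4 + d 4 :=
    hinh (0, 5) (4, 4) (by decide) (by decide)
      (show δ₀ 0 + δ₀ 5 < δ₀ 4 + δ₀ 4 by linarith)
  have i6 : d 4 + d 4 < d 1 + d 5 :=
    hinh (4, 4) (1, 5) (by decide) (by decide)
      (show δ₀ 4 + δ₀ 4 < δ₀ 1 + δ₀ 5 by linarith)
  have i7 : d 3 + d 5 < d 4 + d 5 :=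
    hinh (3, 5) (4, 5) (by decide) (by decide)
      (show δ₀ 3 + δ₀ 5 < δ₀ 4 + δ₀ 5 by linarith)
  have i8 : d 4 + d 5 < d 5 + d 5 :=
    hinh (4, 5) (5, 5) (by decide) (by decide)
      (show δ₀ 4 + δ₀ 5 < δ₀ 5 + δ₀ 5 by linarith)
  rcases lt_trichotomy (d 2 + d 2) (d 1 + d 3) with hlt | heq | hgt
  · refine doorA26_on_chamber430 d (strictMono_pairSum_of_isChain d _ ?_)
    simp only [List.ofFn_succ, List.ofFn_zero, Function.comp_apply, Matrix.cons_val_succ, Matrix.cons_val_zero, List.isChain_cons_cons, List.isChain_singleton, and_true, Fin.isValue]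
    omega
  · exact posRootLawOn_of_pairSum_collision d (2, 2) (1, 3) (by decide) (by decide)
      (by decide) heq
  · refine doorA26_on_chamber354 d (strictMono_pairSum_of_isChain d _ ?_)
    simp only [List.ofFn_succ, List.ofFn_zero, Function.comp_apply, Matrix.cons_val_succ, Matrix.cons_val_zero, List.isChain_cons_cons, List.isChain_singleton, and_true, Fin.isValue]
    omega

/-- **Component `(1, 3, 1, 1)` at the reduced order of `(0, 4, 6, 9)` is outside `closure TwentyLocus`** (refining chambers 351, 427, both kernel rows). [this work] -/
theorem tripleStratum_oneThreeOneOne_0469 (δ₀ : Fin 6 → ℝ) (hΔ : δ₀ ∈ Bubbling.SortedSimplex)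
    (ht₁ : δ₀ 1 = δ₀ 2) (ht₂ : δ₀ 2 = δ₀ 3)
    (hR : δ₀ 0 + δ₀ 0 < δ₀ 0 + δ₀ 1 ∧
      δ₀ 0 + δ₀ 1 < δ₀ 0 + δ₀ 4 ∧
      δ₀ 0 + δ₀ 4 < δ₀ 1 + δ₀ 1 ∧
      δ₀ 1 + δ₀ 1 < δ₀ 0 + δ₀ 5 ∧
      δ₀ 0 + δ₀ 5 < δ₀ 1 + δ₀ 4 ∧
      δ₀ 1 + δ₀ 4 < δ₀ 4 + δ₀ 4 ∧
      δ₀ 4 + δ₀ 4 < δ₀ 1 + δ₀ 5 ∧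
      δ₀ 1 + δ₀ 5 < δ₀ 4 + δ₀ 5 ∧
      δ₀ 4 + δ₀ 5 < δ₀ 5 + δ₀ 5) :
    δ₀ ∉ closure Bubbling.TwentyLocus := by
  obtain ⟨c1, c2, c3, c4, c5, c6, c7, c8, c9⟩ := hR
  refine not_mem_closure_bubblingTwentyLocus_of_sortedRows δ₀ hΔ.1 fun d hd hinh => ?_
  have l₁ : d 1 < d 2 := hd (by decide)
  have l₂ : d 2 < d 3 := hd (by decide)
  have i0 : d 0 + d 0 < d 0 + d 1 :=
    hinh (0, 0) (0, 1) (by decide) (by decide)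
      (show δ₀ 0 + δ₀ 0 < δ₀ 0 + δ₀ 1 by linarith)
  have i1 : d 0 + d 3 < d 0 + d 4 :=
    hinh (0, 3) (0, 4) (by decide) (by decide)
      (show δ₀ 0 + δ₀ 3 < δ₀ 0 + δ₀ 4 by linarith)
  have i2 : d 0 + d 4 < d 1 + d 1 :=
    hinh (0, 4) (1, 1) (by decide) (by decide)
      (show δ₀ 0 + δ₀ 4 < δ₀ 1 + δ₀ 1 by linarith)
  have i3 : d 3 + d 3 < d 0 + d 5 :=
    hinh (3, 3) (0, 5) (by decide) (by decide)
      (show δ₀ 3 + δ₀ 3 < δ₀ 0 + δ₀ 5 by linarith)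
  have i4 : d 0 + d 5 < d 1 + d 4 :=
    hinh (0, 5) (1, 4) (by decide) (by decide)
      (show δ₀ 0 + δ₀ 5 < δ₀ 1 + δ₀ 4 by linarith)
  have i5 : d 3 + d 4 < d 4 + d 4 :=
    hinh (3, 4) (4, 4) (by decide) (by decide)
      (show δ₀ 3 + δ₀ 4 < δ₀ 4 + δ₀ 4 by linarith)
  have i6 : d 4 + d 4 < d 1 + d 5 :=
    hinh (4, 4) (1, 5) (by decide) (by decide)
      (show δ₀ 4 + δ₀ 4 < δ₀ 1 + δ₀ 5 by linarith)
  have i7 : d 3 + d 5 < d 4 + d 5 :=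
    hinh (3, 5) (4, 5) (by decide) (by decide)
      (show δ₀ 3 + δ₀ 5 < δ₀ 4 + δ₀ 5 by linarith)
  have i8 : d 4 + d 5 < d 5 + d 5 :=
    hinh (4, 5) (5, 5) (by decide) (by decide)
      (show δ₀ 4 + δ₀ 5 < δ₀ 5 + δ₀ 5 by linarith)
  rcases lt_trichotomy (d 2 + d 2) (d 1 + d 3) with hlt | heq | hgt
  · refine doorA26_on_chamber427 d (strictMono_pairSum_of_isChain d _ ?_)
    simp only [List.ofFn_succ, List.ofFn_zero, Function.comp_apply, Matrix.cons_val_succ, Matrix.cons_val_zero, List.isChain_cons_cons, List.isChain_singleton, and_true, Fin.isValue]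
    omega
  · exact posRootLawOn_of_pairSum_collision d (2, 2) (1, 3) (by decide) (by decide)
      (by decide) heq
  · refine doorA26_on_chamber351 d (strictMono_pairSum_of_isChain d _ ?_)
    simp only [List.ofFn_succ, List.ofFn_zero, Function.comp_apply, Matrix.cons_val_succ, Matrix.cons_val_zero, List.isChain_cons_cons, List.isChain_singleton, and_true, Fin.isValue]
    omega

end Summit.ValiantsHypothesis.ValiantsHypothesis.Theorems.LacunarySymmetroidMatrixDescartes.Census.RealExp
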